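import Summits.QuantumAdvantage.QuantumAdvantage.Theses.CubicForrelation
import Literature.Computability.QuantumComplexity.ForrelationDerivativeTables
import Literature.Computability.QuantumComplexity.ForrelationSignTransport
import Literature.Computability.QuantumComplexity.ForrelationDirectSum

/-!
# Line `two-sided-almost-bentness` — skeleton for crux `CubicForrelation.NearExactIsExact`
(stmt-QuantumAdvantage-14043), crux-plan seat `planner-cruxplan-stmt-QuantumAdvantage-14043-two-sided-almost-ben-0`,
round 1, 2026-08-16.

Crux (route `CubicForrelation`, rank 2): `∃ θ < 1, ∀ even n, ∀ cubic f g : 𝔽₂ⁿ → 𝔽₂, Φ(f,g) > θ ⇒ Φ(f,g) = 1`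
(`Negative.nearExactIsExact_iff` is `Iff.rfl`; by `Negative.not_nearExact_at_of_lt` every admissible `θ` is `≥ 15/16`).

## The line (idea card `Ideas/two-sided-almost-bentness.md`, triage r1: 3 × pass)

LEVER (`stub_almostBent`, provable now). With `G = 2^{-n/2} W_g`, `F = (−1)^f`: `Φ = E FG`, `E G² = 1` (Parseval), so
`‖G − F‖₂² = 2(1 − Φ)` and `E|G² − 1| = E|G − F|·|G + F| ≤ 2√(2(1−Φ))` — near-exactness forces the g-side (and, by
symmetry of `Φ`, the f-side) to be L¹-ALMOST BENT. Unnormalised: `sqDefect g = Σ_x |W_g(x)² − 2ⁿ| ≤ 2√(2(1−Φ))·4ⁿ`.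

INVERSE STEP (`stub_almostBentInverse`, HARDEST, the card's conjecture ALMOSTBENTINVERSE⁺ in the exact-membership form
the triage asked for). An absolute `η₀ > 0` such that every CUBIC `g` on an even number of bits with `sqDefect g ≤ η₀·4ⁿ`
lies in the class 𝔐 = `MMBentFibre`: in some linear coordinates `(z, y″, y′) ∈ 𝔽₂^m × 𝔽₂^k × 𝔽₂^k` (any `k`, `n = m + 2k`),
`g = y′·ρ(y″) ⊕ h(y″, z)` with `ρ : 𝔽₂^k → 𝔽₂^k` quadratic and every fibre `h(y″, ·)` bent on `𝔽₂^m`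
(`k = 0`: g is bent — in particular every non-MM# cubic bent function is in 𝔐; `m = 0`: Maiorana–McFarland SHAPE with a
quadratic, not necessarily bijective, map — the near-injective maps of ATTACK (C)/(D) and the `𝔽_{2^r}` pencil of Disproof §4;
𝔐 is closed under direct sums). For cubic `g` "O(η)-close to 𝔐" already means "in 𝔐" (`d_min RM(3,n) = 2ⁿ/8`, triage r1-1),
hence exact membership.

CAPTURE (`stub_capture`, provable; Disproof §3 / ATTACK (A) generalised from MM shape to 𝔐). If `g ∈ 𝔐` and `f` is cubic with
`Φ(f,g) > 15/16` then `ρ` is a permutation, hence `g` is BENT. In adapted coordinates write the `f`-variable as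
`x = (c, a, b)` (blocks paired by the twist with `(z, y″, y′)`); then `W_g(c,a,b) = 2^k Σ_{y″ ∈ ρ⁻¹(b)} (−1)^{a·y″} W_{h(y″,·)}(c)`
and, the fibres being bent with duals `h̃_{y″}`, `Φ = 2^{−n} Σ_{y″,c} (−1)^{h̃_{y″}(c)} W_{f(c,·,ρ y″)}(y″)` (inner Walsh sum over
the block `a ∈ 𝔽₂^k`). The set `A = {(c,b) : f(c,·,b) affine}` is a flat (the coefficient of `a_i a_j` in a cubic is affine in
`(c,b)`); off `A` the inner sum is `≤ (3/4)·2^k` (a non-affine cubic in `a` is `≥ 1/8`-far from affine), so `Φ > 15/16` forces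
`(c, ρ y″) ∈ A` identically (a non-zero condition of degree `≤ 2` in `(c,y″)` fails on `≥ 1/4` of the points); then
`f = a·τ(c,b) ⊕ κ(c,b)` on `A` with `τ` quadratic, `Φ ≤ Pr_{y″,c}[τ(c, ρ y″) = y″]`, and `τ∘(id × ρ) ⊕ pr` has degree `≤ 4`,
so it vanishes identically or on `≤ 15/16` of the points (`d_min RM(4) = 2^{−4}`·length): `ρ` is injective, hence bijective, and
`W_g(c,a,b) = 2^k (−1)^{a·ρ⁻¹b} W_{h(ρ⁻¹ b,·)}(c) = ±2^{n/2}`.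

BENT CASE (`stub_bentSidedIsolation` = the crux restricted to bent `g` = the card's DualDistanceGap = card
`low-rank-dyadic-rigidity`'s BentSidedIsolation; SHARED, file once): `∃ θ_b < 1`, cubic `f`, cubic BENT `g`, `Φ > θ_b ⇒ Φ = 1`,
i.e. the dual of a cubic bent function is cubic or `≥ (1−θ_b)/2`-far from `RM(3,n)`. Known: `θ_b ≥ 15/16` (the 15/16 witness
is bent × bent, `Negative.forrelation_f16_g16`); automatic with `θ_b = 1 − 2^{1−d}` while `deg g̃ ≤ d` (so for `n ≤ 4d − 4` by Hou,
`carlet2020_prop74_houDualDegree`); inside MM# the ceiling is `31/32` (Disproof §3, open whether attained).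

COMPOSITION (`nearExact_of_parts`, sorry-free): `θ := max(15/16, θ_b, 1 − η₀²/8)`; `Φ > θ` ⇒ (lever) `sqDefect g ≤ η₀ 4ⁿ`
⇒ (inverse) `g ∈ 𝔐` ⇒ (capture, `Φ > 15/16`) `g` bent ⇒ (bent case, `Φ > θ_b`) `Φ = 1`.
`NearExactIsExact_of : NearExactIsExact` instantiates it with the four registered stubs (crux BY NAME; `sorry` only in `stub_*`).

Disproof used (`Cruxes/NearExactIsExact/Disproof.lean`, cdisprove cycle 1, + the landed
`Theorems/NearExactIsExact/Negative/FifteenSixteenths.lean` — read; NOT imported only because the farm snapshot reported that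
module `unbuilt` at check time (05:57Z); its content used here is `nearExactIsExact_iff = Iff.rfl`, restated as `crux_iff`): there are no `_false_without_<H>` theorems yet; the
load-bearing analysis §4 (`CruxWithoutDegF`, PAPER-false: cubicity of `f` is load-bearing) is honoured at `stub_capture`
(uses `hf`: the degree-2/degree-4 rigidity of `A` and of `τ∘ρ`) and at `stub_bentSidedIsolation` (takes `IsDegLeFun 3 f`;
for the `𝔽_{2^r}` pencil `g_r ∈ 𝔐` the partner `f_r` has degree `r+1`); §1–2 (`15/16`, bent × bent, both MM) is consistent with
every stub: the lever is silent there (`sqDefect = 0`, `sqDefect_eq_zero_of_isBentB`), `g16 ∈ 𝔐` (k = 0 and k = 8), capture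
holds (g16 IS bent), and the pair sits inside `stub_bentSidedIsolation` forcing `θ_b ≥ 15/16` — no stub asserts a threshold
below `15/16` except capture's `15/16` itself, whose conclusion (bentness) g16 satisfies; §3 (MM ceiling 31/32) lives inside
`stub_bentSidedIsolation`; §5 (granularity wall) is exactly why `stub_capture` closes at a fixed degree (4).
No landed Negative lemma refutes a stub instance (the only landed facts are the 15/16 witness and `nearExactIsExact_iff_ge`).

Coordinates convention: adapted coordinates are `Fin (m + (k + k))`, a point is `Fin.append z (Fin.append y″ y′)`
(`z : Fin m → Bool` the bent-fibre block, `y″` the argument of `ρ`, `y′` the linear block); with `k = 0` the type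
`Fin (n + (0 + 0)) → Bool` is definitionally `Fin n → Bool` (used in `mmBentFibre_of_isBentB`).
-/

set_option linter.dupNamespace false
set_option linter.unusedVariables false

noncomputable section

namespace Summit.QuantumAdvantage.QuantumAdvantage.Cruxes.NearExactIsExact.TwoSidedAlmostBentness

open Finset
open Literature.Computability.QuantumComplexity
open Literature.Computability.QuantumComplexity.BuzetChailloux (signOf_sq bxor zeroVec)
open Literature.Computability.QuantumComplexity.DerivativeWalsh
  (W fsum two_pow_mul_W_eq fsum_signOf_sq_of_forrelation_sq sum_W_sq)
open Summit.QuantumAdvantage.QuantumAdvantage.Theses.CubicForrelation (NearExactIsExact)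

variable {n : ℕ}

/-- The crux, unfolded (definitional; same as `Negative.nearExactIsExact_iff` / `Disproof.crux_iff`, restated here so the
skeleton does not depend on the farm having built the Negative module). -/
theorem crux_iff : NearExactIsExact ↔ ∃ θ : ℝ, θ < 1 ∧
    ∀ n : ℕ, Even n → ∀ f g : (Fin n → Bool) → Bool, IsDegLeFun 3 f → IsDegLeFun 3 g →
      θ < forrelation f g → forrelation f g = 1 := Iff.rfl

/-! ### Vocabulary -/

/-- The unnormalised L¹-defect of `|G|²`: `sqDefect g = Σ_x |W_g(x)² − 2ⁿ|` (so `E|G² − 1| = sqDefect g / 4ⁿ` with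
`G = 2^{-n/2} W_g`). It vanishes iff `g` is bent. -/
def sqDefect (g : (Fin n → Bool) → Bool) : ℝ :=
  ∑ x, |W (fun y => signOf (g y)) x ^ 2 - (2 : ℝ) ^ n|

/-- Bentness in the tree's Bool/`W` vocabulary: `W_h(c)² = 2^m` for every `c` (forces `m` even as soon as it holds at one `c`,
since `W_h(c)` is an integer). -/
def IsBentB {m : ℕ} (h : (Fin m → Bool) → Bool) : Prop :=
  ∀ c : Fin m → Bool, W (fun z => signOf (h z)) c ^ 2 = (2 : ℝ) ^ m

/-- A DUAL PAIR of coordinate systems: bijections `e` (for the `g`-variable) and `e'` (for the `f`-variable) with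
`(e' x)·(e y) = x·y`; this forces both to be `𝔽₂`-linear with `e' = (e⁻¹)ᵀ`, and gives
`forrelation f g = forrelation (f ∘ e'.symm) (g ∘ e.symm)` by reindexing both sums. -/
def IsDualPair {N : ℕ} (e e' : (Fin n → Bool) ≃ (Fin N → Bool)) : Prop :=
  ∀ x y, twist (e' x) (e y) = twist x y

/-- The class 𝔐 ("Maiorana–McFarland shape with a quadratic map and bent fibres", Carlet's generalised MM construction
WITHOUT the bijectivity of the map): in some dual pair of linear coordinates `Fin (m + (k + k))`,
`(−1)^{g(z, y″, y′)} = (−1)^{y′·ρ(y″)} · (−1)^{h(y″, z)}` with every coordinate of `ρ : 𝔽₂^k → 𝔽₂^k` of degree `≤ 2`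
and every fibre `h(y″, ·) : 𝔽₂^m → 𝔽₂` bent. `k = 0`: `g` bent; `m = 0`: plain MM shape `y′·ρ(y″) ⊕ h(y″)`. -/
def MMBentFibre (g : (Fin n → Bool) → Bool) : Prop :=
  ∃ (k m : ℕ) (e e' : (Fin n → Bool) ≃ (Fin (m + (k + k)) → Bool)), IsDualPair e e' ∧
    ∃ (ρ : (Fin k → Bool) → (Fin k → Bool)) (h : (Fin k → Bool) → (Fin m → Bool) → Bool),
      (∀ i : Fin k, IsDegLeFun 2 (fun y => ρ y i)) ∧ (∀ y₂ : Fin k → Bool, IsBentB (h y₂)) ∧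
      ∀ (z : Fin m → Bool) (y₂ y₁ : Fin k → Bool),
        signOf (g (e.symm (Fin.append z (Fin.append y₂ y₁)))) = twist y₁ (ρ y₂) * signOf (h y₂ z)

/-! ### Small certified glue (no sorry): the vocabulary is live and non-vacuous -/

/-- On a bent function the lever's quantity vanishes (the lever is silent on the 15/16 witness, both of whose sides are bent). -/
theorem sqDefect_eq_zero_of_isBentB (g : (Fin n → Bool) → Bool) (hg : IsBentB g) : sqDefect g = 0 := by
  unfold sqDefect
  refine sum_eq_zero fun x _ => ?_
  rw [hg x, sub_self, abs_zero]

/-- Exact pairs are in the scope of `stub_bentSidedIsolation`: `Φ(f,g) = 1 ⇒ g` bent (Cauchy–Schwarz/Parseval, tree theorem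
`DerivativeWalsh.two_pow_mul_W_eq`). -/
theorem isBentB_of_forrelation_eq_one (f g : (Fin n → Bool) → Bool) (h : forrelation f g = 1) : IsBentB g := by
  intro c
  have hS := fsum_signOf_sq_of_forrelation_sq f g (by rw [h]; norm_num)
  have hx := two_pow_mul_W_eq (fun x => signOf (f x)) (fun y => signOf (g y))
    (fun x => signOf_sq (f x)) (fun y => signOf_sq (g y)) hS c
  have h2 : ((2 : ℝ) ^ n * W (fun y => signOf (g y)) c) ^ 2 = (8 : ℝ) ^ n := by
    rw [hx, mul_pow, hS, signOf_sq, mul_one]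
  have h8 : (8 : ℝ) ^ n = (2 : ℝ) ^ n * (2 : ℝ) ^ n * (2 : ℝ) ^ n := by
    rw [← mul_pow, ← mul_pow]; norm_num
  rw [mul_pow, ← pow_mul, show n * 2 = n + n by ring, pow_add, h8] at h2
  have hnz : (2 : ℝ) ^ n * (2 : ℝ) ^ n ≠ 0 := by positivity
  exact mul_left_cancel₀ hnz h2

/-- Non-vacuity of 𝔐 / the `k = 0` stratum: every bent `g` (e.g. every non-MM# cubic bent function, and both sides of the 15/16
witness) is in `MMBentFibre` — frame dimension `0`, identity coordinates, `h(·, z) = g z`. -/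
theorem mmBentFibre_of_isBentB (g : (Fin n → Bool) → Bool) (hg : IsBentB g) : MMBentFibre g := by
  refine ⟨0, n, Equiv.refl _, Equiv.refl _, fun x y => rfl, fun y => y, fun _ z => g z,
    fun i => i.elim0, fun _ => hg, ?_⟩
  intro z y₂ y₁
  have h1 : twist y₁ y₂ = 1 := by
    unfold twist
    exact Fintype.prod_empty _
  have h2 : Fin.append z (Fin.append y₂ y₁) = z := by
    funext i
    exact Fin.append_left z (Fin.append y₂ y₁) i
  show signOf (g (Fin.append z (Fin.append y₂ y₁))) = twist y₁ y₂ * signOf (g z)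
  rw [h1, one_mul, h2]

/-! ### Registered stubs -/

/-- STUB 1 — the LEVER (M; provable now from `DerivativeWalsh.sum_W_sq` + Cauchy–Schwarz; valid for ALL Boolean `f, g`, no
degree hypothesis). With `G = 2^{-n/2}W_g`, `F = (−1)^f`: `E(G − F)² = 2(1 − Φ)`, `E(G + F)² = 2(1 + Φ) ≤ 4`, and
`|G² − 1| = |G − F|·|G + F|`, so `E|G² − 1| ≤ √(2(1−Φ))·2`; multiply by `4ⁿ`. (When `Φ > 1` is impossible anyway; when the
radicand is negative `Real.sqrt` is `0` and the claim still holds since then `Φ > 1`.) Two-sided by `Φ(f,g) = Φ(g,f)`. -/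
theorem stub_almostBent (f g : (Fin n → Bool) → Bool) :
    sqDefect g ≤ 2 * Real.sqrt (2 * (1 - forrelation f g)) * (2 : ℝ) ^ (2 * n) := by
  sorry

/-- STUB 2 — HARDEST (XL; NEW: the inverse theorem ALMOSTBENTINVERSE⁺ of the idea card, exact-membership form). There is an
absolute `η₀ > 0` such that every cubic `g` on an even number `n` of bits whose squared Walsh spectrum is L¹-close to flat,
`Σ_x |W_g(x)² − 2ⁿ| ≤ η₀·4ⁿ`, is of Maiorana–McFarland shape with a quadratic map and bent fibres in some dual pair of linear
coordinates (`MMBentFibre g`; frame dimension `k` free, `0 ≤ 2k ≤ n`). Why plausible: the L¹-defect has the dyadic expansion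
`G² − 1 = Σ_{w ∈ U(g)} ±2^{−rank(D_w g)/2} χ_w` over the UNBALANCED derivative directions (Wiener–Khinchin + Dickson), so the
hypothesis says "few-or-high-rank unbalanced derivatives" quantitatively; every almost-bent cubic on record is in 𝔐 (bent:
k = 0; near-injective MM shapes and the `𝔽_{2^r}` pencil: m = 0; direct sums; degenerate-fibre and z-dependent-map toy
deformations re-enter 𝔐 through a LARGER frame — see the line card). Why it might fail: no template inverse theorem for an
L¹ (not U^k) 99%-condition; a family of cubics `g_t ∉ 𝔐` with `sqDefect g_t / 4ⁿ → 0` kills it (cheapest hunting ground: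
cubic-in-z fibre parts `H₃(z)` with no affine structure glued to a near-injective map through a sparse cubic coupling). -/
theorem stub_almostBentInverse :
    ∃ η₀ : ℝ, 0 < η₀ ∧ ∀ (n : ℕ), Even n → ∀ g : (Fin n → Bool) → Bool, IsDegLeFun 3 g →
      sqDefect g ≤ η₀ * (2 : ℝ) ^ (2 * n) → MMBentFibre g := by
  sorry

/-- STUB 3 — CAPTURE (L; provable: Disproof §3 / ATTACK (A) generalised to bent fibres). If `g ∈ 𝔐` and `f` is CUBIC with
`Φ(f,g) > 15/16`, then the quadratic map `ρ` of the normal form is a permutation and therefore `g` is bent. Steps, writing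
the `f`-variable in the dual adapted coordinates as `x = (c, a, b)` (paired with `(z, y″, y′)`): (i) transport `Φ`,
cubicity and `W²` along the dual pair (`forrelation f g = forrelation (f ∘ e'.symm) (g ∘ e.symm)` by reindexing both sums
with `IsDualPair`; duality + bijectivity make `e, e'` linear, so degrees are preserved); (ii)
`W_g(c,a,b) = 2^k Σ_{y″ ∈ ρ⁻¹ b} (−1)^{a·y″} W_{h(y″,·)}(c)` and `Φ = 2^{−n} Σ_{y″,c} (−1)^{h̃_{y″}(c)} W_{f(c,·,ρ y″)}(y″)`
(sum over the linear block `y′` first: `ForrelationDirectSum.sum_append`, `twist_append`, `Simon.sum_twist`); (iii)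
`A = {(c,b) : f(c,·,b) affine in a}` is cut out by affine equations (the coefficient of `a_i a_j` in a cubic is affine in
`(c,b)`); a non-zero function of degree `≤ 2` in `(c,y″)` is non-zero on `≥ 1/4` of the points and a non-affine cubic in `a`
has `|W| ≤ (3/4)·2^k`, so `Φ > 15/16 ⇒ (c, ρ y″) ∈ A` for all `c, y″`; (iv) on `A`, `f = a·τ(c,b) ⊕ κ(c,b)` with `τ` quadratic,
`Φ ≤ Pr_{y″,c}[τ(c, ρ y″) = y″]`, and a non-zero function of degree `≤ 4` is non-zero on `≥ 1/16` of the points (induction on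
the degree with the tree's derivative-defined `lowDeg` of `F2PolynomialFourierTailsLevelKProofs.lean`:
`#supp G ≥ ½·#supp(der a G)`), so `τ(c, ρ y″) = y″` identically and `ρ` is injective, hence bijective; (v) then
`W_g(c,a,b) = 2^k (−1)^{a·ρ⁻¹ b} W_{h(ρ⁻¹ b,·)}(c)`, of square `4^k·2^m = 2ⁿ`. MUST use `hf` (Disproof §4: the `𝔽_{2^r}`
pencil `g_r` is in 𝔐, non-bent, and its degree-`(r+1)` partner has `Φ → 1`). -/
theorem stub_capture (f g : (Fin n → Bool) → Bool) (hf : IsDegLeFun 3 f) (hM : MMBentFibre g)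
    (hΦ : (15 : ℝ) / 16 < forrelation f g) : IsBentB g := by
  sorry

/-- STUB 4 — BENT-SIDED ISOLATION (XL; = the crux restricted to bent `g`; = DualDistanceGap of the idea card = BentSidedIsolation
of card `low-rank-dyadic-rigidity` — ONE shared statement for both lines). There is `θ_b < 1` such that for cubic `f` and cubic
BENT `g` on an even number of bits, `Φ(f,g) > θ_b ⇒ Φ(f,g) = 1`; equivalently (`Φ = 1 − 2·dist(f, g̃)/2ⁿ`) the dual of a cubic
bent function is cubic or at relative distance `≥ (1 − θ_b)/2` from `RM(3,n)`. Necessarily `θ_b ≥ 15/16`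
(`Negative.forrelation_f16_g16`: bent × bent, duals of degree 5); automatic at `θ_b = 1 − 2^{1−d}` whenever `deg g̃ ≤ d`
(`carlet2020_thm7`), hence for `n ≤ 4d − 4` by Hou (`carlet2020_prop74_houDualDegree`); `31/32` is the ceiling inside MM#
(Disproof §3). Why it might fail: cubic bent `g_n` (necessarily with `deg g̃_n → ∞`, so non-MM# phenomena at `n → ∞`) whose
duals are `o(1)`-close to but not in `RM(3,n)`. -/
theorem stub_bentSidedIsolation :
    ∃ θ : ℝ, θ < 1 ∧ ∀ (n : ℕ), Even n → ∀ f g : (Fin n → Bool) → Bool, IsDegLeFun 3 f → IsDegLeFun 3 g →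
      IsBentB g → θ < forrelation f g → forrelation f g = 1 := by
  sorry

/-! ### Composition (kernel-checked, sorry-free) -/

/-- **The composition with the four stub STATEMENTS as hypotheses** (sorry-free): lever ⇒ almost-bent ⇒ (inverse) `g ∈ 𝔐`
⇒ (capture at `15/16`) `g` bent ⇒ (bent-sided isolation) `Φ = 1`, with `θ = max(15/16, θ_b, 1 − η₀²/8)` (the last so that
`2√(2(1−Φ)) < η₀`). Concludes the crux BODY (`Negative.nearExactIsExact_iff` is `Iff.rfl`). -/
theorem nearExact_of_parts
    (h1 : ∀ (n : ℕ) (f g : (Fin n → Bool) → Bool),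
      sqDefect g ≤ 2 * Real.sqrt (2 * (1 - forrelation f g)) * (2 : ℝ) ^ (2 * n))
    (h2 : ∃ η₀ : ℝ, 0 < η₀ ∧ ∀ (n : ℕ), Even n → ∀ g : (Fin n → Bool) → Bool, IsDegLeFun 3 g →
      sqDefect g ≤ η₀ * (2 : ℝ) ^ (2 * n) → MMBentFibre g)
    (h3 : ∀ (n : ℕ) (f g : (Fin n → Bool) → Bool), IsDegLeFun 3 f → MMBentFibre g →
      (15 : ℝ) / 16 < forrelation f g → IsBentB g)
    (h4 : ∃ θ : ℝ, θ < 1 ∧ ∀ (n : ℕ), Even n → ∀ f g : (Fin n → Bool) → Bool, IsDegLeFun 3 f → IsDegLeFun 3 g →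
      IsBentB g → θ < forrelation f g → forrelation f g = 1) :
    ∃ θ : ℝ, θ < 1 ∧ ∀ n : ℕ, Even n → ∀ f g : (Fin n → Bool) → Bool, IsDegLeFun 3 f → IsDegLeFun 3 g →
      θ < forrelation f g → forrelation f g = 1 := by
  obtain ⟨η₀, hη₀, hinv⟩ := h2
  obtain ⟨θb, hθb, hbent⟩ := h4
  have hη8 : 0 < η₀ ^ 2 / 8 := by
    have := pow_pos hη₀ 2
    linarith
  refine ⟨max (max (15 / 16) θb) (1 - η₀ ^ 2 / 8), max_lt (max_lt (by norm_num) hθb) (by linarith), ?_⟩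
  intro n hn f g hf hg hΦ
  have h15 : (15 : ℝ) / 16 < forrelation f g :=
    lt_of_le_of_lt ((le_max_left _ _).trans (le_max_left _ _)) hΦ
  have hb : θb < forrelation f g :=
    lt_of_le_of_lt ((le_max_right _ _).trans (le_max_left _ _)) hΦ
  have hη : 1 - η₀ ^ 2 / 8 < forrelation f g := lt_of_le_of_lt (le_max_right _ _) hΦ
  -- the lever at level η₀
  have hdef : sqDefect g ≤ η₀ * (2 : ℝ) ^ (2 * n) := by
    have hsq : Real.sqrt (2 * (1 - forrelation f g)) < η₀ / 2 := by
      rw [Real.sqrt_lt' (half_pos hη₀)]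
      have e : (η₀ / 2) ^ 2 = η₀ ^ 2 / 4 := by ring
      rw [e]
      linarith
    have hpow : (0 : ℝ) ≤ (2 : ℝ) ^ (2 * n) := by positivity
    calc sqDefect g ≤ 2 * Real.sqrt (2 * (1 - forrelation f g)) * (2 : ℝ) ^ (2 * n) := h1 n f g
      _ ≤ η₀ * (2 : ℝ) ^ (2 * n) := by
          apply mul_le_mul_of_nonneg_right _ hpow
          linarith
  have hM : MMBentFibre g := hinv n hn g hg hdef
  have hB : IsBentB g := h3 n f g hf hM h15
  exact hbent n hn f g hf hg hB hb

/-- **THE COMPOSITION.** The crux `CubicForrelation.NearExactIsExact` BY NAME from the four registered stubs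
(`sorry` lives only inside `stub_*`). -/
theorem NearExactIsExact_of : NearExactIsExact :=
  crux_iff.2
    (nearExact_of_parts (fun n f g => stub_almostBent f g) stub_almostBentInverse
      (fun n f g hf hM hΦ => stub_capture f g hf hM hΦ) stub_bentSidedIsolation)

end Summit.QuantumAdvantage.QuantumAdvantage.Cruxes.NearExactIsExact.TwoSidedAlmostBentness

end
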